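import Literature.InformationTheory.QuantumCodes.CSS
import HarnessLib

/-!
# CSS parameters in `ℕ∞` form (`cssDistX`, `cssDistZ`, `cssDim`) and the census predicate `[[n, k, d]]`

Companion to `CSS.lean` (check-matrix CSS codes `CSSCode RX RZ Q`, `dX`/`dZ`/`k : ℕ`) and to
Tillich–Zémor's `cssMinDist : ℕ∞` (`HypergraphProduct.lean`), fixing the names of LADDER-QEC PARTITION
v2 D2.2/D2.3:

* `cssDistX H^X H^Z`, `cssDistZ H^X H^Z : ℕ∞` — the `X`- and `Z`-distances `min {|v| : v ∈ ker H^Z ∖ rs H^X}`,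
  `min {|v| : v ∈ ker H^X ∖ rs H^Z}` (Bravyi et al. 2024 §4, proof of Lemma 1) in the tree's `ℕ∞`
  convention (`⊤` when there is no logical operator of that type — Tillich–Zémor §5 "the minimum distance
  of a code reduced to the all-zero codeword is ∞"), matrix-level (no commutation hypothesis needed to
  state them); PROVED: `cssMinDist_eq_min_cssDistX_cssDistZ` (`D = min (d^X, d^Z)` in `ℕ∞`,
  unconditionally), and for a CSS code `C` the bridges `CSSCode.cssDistX_eq_dX` (`= ↑dX` when an
  `X`-logical exists) / `CSSCode.cssDistX_eq_top` (`= ⊤` when none);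
* `cssDim H^X H^Z = |Q| − rank H^X − rank H^Z : ℕ` (the printed `k`; `CSSCode.cssDim_eq_k`);
* the census / CLAIM predicate **`CSSCode.IsCode C n k d`** `:= |Q| = n ∧ C.k = k ∧ cssMinDist H^X H^Z = d`
  — "`C` is an `[[n, k, d]]` code" with the distance EXACT and read through `cssMinDist` (PARTITION v2
  D2.2), so `k = 0` codes (distance `⊤`) are never instances; `isCode_iff` (`k > 0`:
  `↔ |Q| = n ∧ C.k = k ∧ min dX dZ = d`), `isCode_of_dX_dZ` (a certificate proving `dX = d₁`, `dZ = d₂`,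
  `k > 0` yields `[[|Q|, k, min(d₁,d₂)]]`), `IsCode.k_pos`.

## References (locators read on the page)

* [BravyiEtAl2024] Bravyi–Cross–Gambetta–Maslov–Rall–Yoder, Nature 627 (2024) 778 = arXiv:2308.07915,
  §4 Lemma 1 and proof (arXiv chunk p0009 L63–117: `[[n,k,d]]`, `k = n − rk H^X − rk H^Z`,
  `d = min(d^X,d^Z)`, `d^X = min{|v| : v ∈ ker H^Z ∖ rs H^X}`, `d^Z = min{|v| : v ∈ ker H^X ∖ rs H^Z}`).
* [TillichZemor2014] Tillich–Zémor, IEEE Trans. IT 60 (2014) 1193 = arXiv:0903.0566v1, §2 (chunk p0004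
  L9-18: minimum distance of a CSS code), §5 (chunk p0008 L3-4: distance `∞` for the zero code).
* [Gottesman1997] D. Gottesman, arXiv:quant-ph/9705052, §2.3 (chunk p0014 L5-8: the notation `[[n,k,d]]`).
-/

namespace Literature.InformationTheory.QuantumCodes

open Matrix

variable {RX RZ Q : Type*} [Fintype Q]

/-! ### `ℕ∞`-valued sector distances and the printed dimension -/

/-- The **`X`-distance in `ℕ∞`**: `d^X = min {|v| : v ∈ ker H^Z ∖ rs H^X}`, `⊤` if there is no `X`-type
logical operator. [cite: BravyiEtAl2024, §4 proof of Lemma 1 (arXiv chunk p0009 L115: "d^X = min{|v| : v ∈ ker H^Z ∖ rs H^X}")]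
[cite: TillichZemor2014, §5 (arXiv v1 chunk p0008 L3-4: distance ∞ when there is no such vector)] -/
noncomputable def cssDistX [Fintype RX] (HX : Matrix RX Q (ZMod 2)) (HZ : Matrix RZ Q (ZMod 2)) : ℕ∞ :=
  ⨅ (v : Q → ZMod 2) (_ : v ∈ pcCode HZ ∧ v ∉ rowSpace HX), (hammingNorm v : ℕ∞)

/-- The **`Z`-distance in `ℕ∞`**: `d^Z = min {|v| : v ∈ ker H^X ∖ rs H^Z}`, `⊤` if there is no `Z`-type
logical operator. [cite: BravyiEtAl2024, §4 proof of Lemma 1 (arXiv chunk p0009 L117: "d^Z = min{|v| : v ∈ ker H^X ∖ rs H^Z}")]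
[cite: TillichZemor2014, §5 (arXiv v1 chunk p0008 L3-4)] -/
noncomputable def cssDistZ [Fintype RZ] (HX : Matrix RX Q (ZMod 2)) (HZ : Matrix RZ Q (ZMod 2)) : ℕ∞ :=
  ⨅ (v : Q → ZMod 2) (_ : v ∈ pcCode HX ∧ v ∉ rowSpace HZ), (hammingNorm v : ℕ∞)

/-- The **printed dimension** `k = n − rank H^X − rank H^Z` (`n = |Q|`) as a natural number (for a CSS
pair the subtraction does not truncate: `CSSCode.rank_HX_add_rank_HZ_le`; equals `CSSCode.k` by
`CSSCode.cssDim_eq_k`). [cite: BravyiEtAl2024, §4 proof of Lemma 1 (arXiv chunk p0009 L80: "k = n − rk(H^X) − rk(H^Z)")] -/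
noncomputable def cssDim (HX : Matrix RX Q (ZMod 2)) (HZ : Matrix RZ Q (ZMod 2)) : ℕ :=
  Fintype.card Q - HX.rank - HZ.rank

/-- `d^Z (H^X, H^Z) = d^X (H^Z, H^X)` (exchange of the `X` and `Z` sides).
[cite: BravyiEtAl2024, §4 proof of Lemma 1 (arXiv chunk p0009 L115-117)] -/
theorem cssDistZ_eq_cssDistX_swap [Fintype RZ] (HX : Matrix RX Q (ZMod 2)) (HZ : Matrix RZ Q (ZMod 2)) :
    cssDistZ HX HZ = cssDistX HZ HX := rfl

/-- `D ≤ d^X ↔` every vector of `ker H^Z ∖ rs H^X` has weight `≥ D`.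
[cite: BravyiEtAl2024, §4 proof of Lemma 1 (arXiv chunk p0009 L115)] -/
theorem le_cssDistX_iff [Fintype RX] {HX : Matrix RX Q (ZMod 2)} {HZ : Matrix RZ Q (ZMod 2)} {D : ℕ∞} :
    D ≤ cssDistX HX HZ ↔ ∀ v : Q → ZMod 2, v ∈ pcCode HZ ∧ v ∉ rowSpace HX → D ≤ (hammingNorm v : ℕ∞) := by
  simp only [cssDistX, le_iInf_iff]

/-- An `X`-logical bounds `d^X` (`ℕ∞` form). [cite: BravyiEtAl2024, §4 proof of Lemma 1 (arXiv chunk p0009 L115)] -/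
theorem cssDistX_le_hammingNorm [Fintype RX] {HX : Matrix RX Q (ZMod 2)} {HZ : Matrix RZ Q (ZMod 2)}
    {v : Q → ZMod 2} (hv : v ∈ pcCode HZ ∧ v ∉ rowSpace HX) : cssDistX HX HZ ≤ (hammingNorm v : ℕ∞) :=
  le_cssDistX_iff.1 le_rfl v hv

/-- **`D = min (d^X, d^Z)` in `ℕ∞`, unconditionally**: Tillich–Zémor's CSS minimum distance (the
minimum over the union `(ker H^X ∖ rs H^Z) ∪ (ker H^Z ∖ rs H^X)`) is the smaller of the two sector
distances. [cite: BravyiEtAl2024, §4 proof of Lemma 1 (arXiv chunk p0009 L109-111: "d = min(d^X, d^Z)")]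
[cite: TillichZemor2014, §2 (arXiv v1 chunk p0004 L9-18)] -/
theorem cssMinDist_eq_min_cssDistX_cssDistZ [Fintype RX] [Fintype RZ] (HX : Matrix RX Q (ZMod 2))
    (HZ : Matrix RZ Q (ZMod 2)) : cssMinDist HX HZ = min (cssDistX HX HZ) (cssDistZ HX HZ) := by
  refine le_antisymm (le_min ?_ ?_) (le_cssMinDist_iff.2 fun e he => ?_)
  · exact le_cssDistX_iff.2 fun v hv => cssMinDist_le_hammingNorm (Or.inr hv)
  · exact le_cssDistX_iff.2 fun v hv => cssMinDist_le_hammingNorm (Or.inl hv)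
  · rcases he with he | he
    · exact (min_le_right _ _).trans (cssDistX_le_hammingNorm he)
    · exact (min_le_left _ _).trans (cssDistX_le_hammingNorm he)

namespace CSSCode

/-- For a CSS code with an `X`-logical (`dX > 0`), the `ℕ∞` distance is the `ℕ` distance:
`cssDistX H^X H^Z = ↑dX`. [cite: BravyiEtAl2024, §4 proof of Lemma 1 (arXiv chunk p0009 L115)] -/
theorem cssDistX_eq_dX [Fintype RX] (C : CSSCode RX RZ Q) (h : 0 < C.dX) :
    cssDistX C.HX C.HZ = (C.dX : ℕ∞) := by
  obtain ⟨v, hv, hv', hvd⟩ := C.exists_hammingNorm_eq_dX ((C.dX_pos_iff).1 h)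
  refine le_antisymm (hvd ▸ cssDistX_le_hammingNorm ⟨hv, hv'⟩) (le_cssDistX_iff.2 fun w hw => ?_)
  exact Nat.cast_le.2 (C.dX_le_hammingNorm hw.1 hw.2)

/-- For a CSS code without `X`-logical (`dX = 0`, the junk value), `cssDistX H^X H^Z = ⊤`.
[cite: TillichZemor2014, §5 (arXiv v1 chunk p0008 L3-4)] -/
theorem cssDistX_eq_top [Fintype RX] (C : CSSCode RX RZ Q) (h : C.dX = 0) : cssDistX C.HX C.HZ = ⊤ := by
  have hX : C.kerZ = C.rowSpX := (C.dX_eq_zero_iff).1 h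
  refine top_le_iff.1 (le_cssDistX_iff.2 fun v hv => ?_)
  exact absurd (hX ▸ hv.1 : v ∈ C.rowSpX) hv.2

/-- `Z`-side bridge: `dZ > 0 ⟹ cssDistZ H^X H^Z = ↑dZ`. [cite: BravyiEtAl2024, §4 proof of Lemma 1 (arXiv chunk p0009 L117)] -/
theorem cssDistZ_eq_dZ [Fintype RZ] (C : CSSCode RX RZ Q) (h : 0 < C.dZ) :
    cssDistZ C.HX C.HZ = (C.dZ : ℕ∞) :=
  C.swap.cssDistX_eq_dX h

/-- `Z`-side: `dZ = 0 ⟹ cssDistZ H^X H^Z = ⊤`. [cite: TillichZemor2014, §5 (arXiv v1 chunk p0008 L3-4)] -/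
theorem cssDistZ_eq_top [Fintype RZ] (C : CSSCode RX RZ Q) (h : C.dZ = 0) : cssDistZ C.HX C.HZ = ⊤ :=
  C.swap.cssDistX_eq_top h

/-- The printed dimension is the CSS code's `k`: `cssDim H^X H^Z = C.k`.
[cite: BravyiEtAl2024, §4 proof of Lemma 1 (arXiv chunk p0009 L80)] -/
theorem cssDim_eq_k [Fintype RX] (C : CSSCode RX RZ Q) : cssDim C.HX C.HZ = C.k := by
  rw [cssDim, C.k_eq]

/-! ### The census predicate `[[n, k, d]]` -/

/-- **`C` is an `[[n, k, d]]` code** (census / CLAIM predicate, PARTITION v2 D2.2): `C` has `n` qubits,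
`k` logical qubits, and minimum distance EXACTLY `d`, the distance being Tillich–Zémor's `ℕ∞`-valued
`cssMinDist` (`= min (d^X, d^Z)` when `k > 0`, `CSSCode.cssMinDist_eq_min_dX_dZ`; `= ⊤` when `k = 0`, so
no `[[n, 0, d]]` instance exists under this predicate — the CRSS `k = 0` convention is `IsAdditiveCode`'s).
[cite: BravyiEtAl2024, §4 Lemma 1 (arXiv chunk p0009 L63-75: "The code has parameters [[n,k,d]]")]
[cite: Gottesman1997, §2.3 (arXiv chunk p0014 L5-8: "a quantum [n,k,d] code is often written [[n,k,d]]")] -/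
def IsCode [Fintype RX] [Fintype RZ] (C : CSSCode RX RZ Q) (n k d : ℕ) : Prop :=
  Fintype.card Q = n ∧ C.k = k ∧ cssMinDist C.HX C.HZ = (d : ℕ∞)

/-- An `[[n, k, d]]` code in this sense has `k > 0` (for `k = 0` the distance is `⊤`, not a number).
[cite: TillichZemor2014, §5 (arXiv v1 chunk p0008 L3-4: distance ∞ for the zero code)] -/
theorem IsCode.k_pos [Fintype RX] [Fintype RZ] {C : CSSCode RX RZ Q} {n k d : ℕ} (h : C.IsCode n k d) :
    0 < k := by
  obtain ⟨-, hk, hd⟩ := h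
  rw [← hk, pos_iff_ne_zero]
  intro h0
  rw [C.cssMinDist_eq_top h0] at hd
  exact ENat.top_ne_coe d hd

/-- **Certificate form of `[[n, k, d]]`**: for `k > 0`, `C` is an `[[n, k, d]]` code iff `|Q| = n`,
`C.k = k` and `min (d^X, d^Z) = d` — so a certificate establishing `dX = d₁`, `dZ = d₂` (via
`dX_eq_of_witness`, `dZ_eq_of_witness`) and `k` (via `k_eq`) discharges the claim `[[n, k, min(d₁,d₂)]]`.
[cite: BravyiEtAl2024, §4 proof of Lemma 1 (arXiv chunk p0009 L109-111: "d = min(d^X, d^Z)")] -/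
theorem isCode_iff [Fintype RX] [Fintype RZ] (C : CSSCode RX RZ Q) {n k d : ℕ} (hk : 0 < C.k) :
    C.IsCode n k d ↔ Fintype.card Q = n ∧ C.k = k ∧ min C.dX C.dZ = d := by
  simp only [IsCode, C.cssMinDist_eq_min_dX_dZ hk, Nat.cast_inj]

/-- From the two sector distances to the claim: `k > 0`, `dX = d₁`, `dZ = d₂ ⟹ [[|Q|, k, min(d₁,d₂)]]`.
[cite: BravyiEtAl2024, §4 proof of Lemma 1 (arXiv chunk p0009 L109-111)] -/
theorem isCode_of_dX_dZ [Fintype RX] [Fintype RZ] (C : CSSCode RX RZ Q) {d₁ d₂ : ℕ} (hk : 0 < C.k)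
    (hX : C.dX = d₁) (hZ : C.dZ = d₂) : C.IsCode (Fintype.card Q) C.k (min d₁ d₂) :=
  (C.isCode_iff hk).2 ⟨rfl, rfl, by rw [hX, hZ]⟩

/-- An `[[n, k, d]]` code has `d^X ≥ d` and `d^Z ≥ d` (as natural numbers), with equality for one of them.
[cite: BravyiEtAl2024, §4 proof of Lemma 1 (arXiv chunk p0009 L109-111)] -/
theorem IsCode.le_dX_and_le_dZ [Fintype RX] [Fintype RZ] {C : CSSCode RX RZ Q} {n k d : ℕ}
    (h : C.IsCode n k d) : d ≤ C.dX ∧ d ≤ C.dZ ∧ (C.dX = d ∨ C.dZ = d) := by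
  obtain ⟨-, -, hmin⟩ := (C.isCode_iff (h.2.1.symm ▸ h.k_pos)).1 h
  refine ⟨hmin ▸ min_le_left _ _, hmin ▸ min_le_right _ _, ?_⟩
  rcases min_choice C.dX C.dZ with hc | hc
  · exact Or.inl (hc ▸ hmin)
  · exact Or.inr (hc ▸ hmin)

end CSSCode

end Literature.InformationTheory.QuantumCodes
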